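import Literature.Probability.LatticeModels.DobrushinShlosmanKernelGeometric
import Summits.Ventures.YMGap.RobustBall.StarDoorZdW
import Summits.Ventures.YMGap.Thresholds.StarInfiniteVolume
import Summits.Ventures.YMGap.Thresholds.StarLemmaGRows
import HarnessLib

/-!
# Venture YMGap, track ROBUST-BALL — FINITE-VOLUME CLUSTERING UNIFORM IN THE BOUNDARY FIELD THROUGH THE `ℤ^d`
# VERTEX-STAR DOORS (interior form), and `SU(2)` lattice Yang–Mills on `ℤ⁴` at EVERY `0 ≤ β_W ≤ 9/25`

HONEST FRAMING. WHAT THIS IS: a venture file (cell `pub-ymgap`, track Y2 ROBUST-BALL, seat ds-3, theorems only): the object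
«C-KMIX-STAR». The kernel clustering cells of `KernelClusteringBall.lean` go through the SINGLE-LINK Dobrushin doors and stop
at the single-link threshold (`SU(2)`, `d = 4`: `β_W < 1/6`, `2/9` through the KR door). The cell's VERTEX-STAR window (ds-4's
Lemma G on the torus, ds-1's transfer `starWindowBoundZd_of_starWindowBound` to `ℤ⁴`, ds-2's radius-`D` door on `ℤ^d`) reaches
`β_W ≤ 9/25`; so far it gave uniqueness and clustering of the infinite-volume STATE only. Here the Literature's kernel form of
the Dobrushin–Shlosman window comparison (`DobrushinShlosman.abs_covariance_kernel_le_of_window`: consistency instead of DLR)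
is fed with the same star arrays:
* `exists_starKernelProfile` — the kernel profile: for a finite link volume `Λ₀`, a `1`-Lipschitz (sup-norm of base points)
  DEPTH FUNCTION `φ` with `φ > 0 ⇒ ∈ Λ₀`, supports `Δf, Δg` and locality radius `D`,
  `ℓ x = min(⌊dist(x, Δg)/(D+2)⌋, ⌊φ x/(D+2)⌋)` is adapted to the stars INSIDE `Λ₀` avoiding `Δg` and
  `ℓ ≥ min(⌊dist(Δf, Δg)/(D+2)⌋, ⌊m/(D+2)⌋)` on `Δf` if `φ ≥ m` there;
* ★★ `abs_covariance_kernel_le_of_starArray` — DOOR LEVEL, any specification `γ` on the links of `ℤ^d` with `SU(N)` spins whose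
  star kernels are quasilocal with a locality set of radius `D` and carry a star array with per-star received sum `≤ ρ < 1`
  (sitewise (H1), Frobenius weight): for EVERY finite `Λ₀`, EVERY boundary field `η`, local Lipschitz `f` (`Δf ⊆ Λ₀`), `g`:
  `|cov_{γ_{Λ₀}(·|η)}(f, g)| ≤ 2(2√N)² ρ^{min(⌊dist(Δf,Δg)/(D+2)⌋, ⌊m/(D+2)⌋)} (Σ δf)(Σ δg)` (GEOMETRIC rate `ρ^{depth}`);
* `abs_covariance_kernel_le_of_starWindowBoundZdR` (ds-2's radius-`D` door `StarWindowBoundZdR`) and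
  `abs_covariance_kernel_le_of_starWindowBoundZd` (ds-1's Wilson door `StarWindowBoundZd`, radius `2`);
* ★★★ `su2_wilson_kernel_clustering_star` — `SU(2)`, `d = 4`, Wilson action, EVERY `0 ≤ β_W ≤ 9/25`, HYPOTHESIS-FREE (Lemma G +
  the torus → `ℤ⁴` transfer, exactly as in `StarInfiniteVolume.su2_hasUniqueGibbsMeasure_le_9_25`): for every finite link
  volume `Λ₀`, EVERY boundary field `η`, every depth function `φ` of `Λ₀` and Lipschitz cylinders `F₁` (links `Λ₁ ⊆ Λ₀`,
  `φ ≥ m` on `Λ₁`), `F₂` (links `Λ₂`):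
  `|cov_{γ_{Λ₀}(·|η)}(F₁, F₂)| ≤ 16 #Λ₁ #Λ₂ K₁ K₂ · R_G(β_W)^{min(⌊dist(Λ₁,Λ₂)/4⌋, ⌊m/4⌋)}`;
  `su2_wilson_kernel_clustering_star_box` — the box `Λ₀ =` links based in `box 4 M` with the depth function `M + 1 − ‖x.1‖_∞`.
WHAT THIS IS NOT: the INTERIOR form only (the rate saturates at the depth of `F₁` inside `Λ₀`; near `∂Λ₀` only stars inside
`Λ₀` are usable — not Dobrushin–Shlosman's complete analyticity, not the total-variation form); strong-coupling LATTICE statements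
(`R_G(β_W) < 1` iff `β_W < 0.3609…`); nothing about the continuum limit or the Clay Millennium problem.

References: R. L. Dobrushin, S. B. Shlosman (1985) Thm. 1, (1987); H. Föllmer, LNM 1362 (1988) Ch. I (2.10), Thm. (2.13); the
Literature's `DobrushinShlosmanKernelGeometric.lean`; ds-2's `RobustBall/StarDoorZd.lean` (followed line by line for the profile);
ds-1's `Thresholds/StarUniquenessZd.lean`, `StarTransferZd.lean`; ds-4's `StarWindowBoundLemmaG.lean`; `StarInfiniteVolume.lean`.
-/

noncomputable section

open MeasureTheory ProbabilityTheory Function Finset Real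
open scoped NNReal
open Literature.Probability.LatticeModels
open Literature.Probability.LatticeModels.DobrushinMetric (IsLipBound)
open Literature.MathematicalPhysics.QuantumLattice
open Literature.MathematicalPhysics.QuantumFieldTheory (suFrobDist suFrobDist_nonneg suFrobDist_le
  suFrobDist_self suEntries dist_suEntries_le_suFrobDist IsLipschitzCylinder
  setDistEdges linkSetDist linkSetDist_nonneg linkSetDist_eq_zero_of_mem setDistEdges_le_linkSetDist
  setDistEdges_nonneg isSpecification_ymSpecification_of_t2Space)
open Summit.Ventures.YMGap.DSWindowZd
open Summit.Ventures.YMGap.StarWindowGauge (gaugeR gaugeR_lt_one_of_le)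
open Summit.Ventures.YMGap.StarLemmaG (starWindowBound_lemmaG gaugeR_nonneg)

namespace Summit.Ventures.YMGap.RobustBall

variable {d N : ℕ}

/-! ### The kernel profile: stars inside a finite volume, away from the support of `g` -/

/-- **THE KERNEL PROFILE FOR THE STAR WINDOWS.** Let `Λ₀` be a finite link volume, `φ` a DEPTH FUNCTION of `Λ₀` — `1`-Lipschitz for the
sup-norm of base points (`φ x ≤ φ y + ‖x.1 − y.1‖_∞`) with `φ x > 0 ⇒ x ∈ Λ₀` — and `nbhd` locality sets of radius `D` around the star
centres (`y ∈ nbhd c ⇒ |y.1 i − c.1 i| ≤ D`). Then the profile `ℓ x = min(⌊dist(x, Δg)/(D+2)⌋, ⌊φ x/(D+2)⌋)` satisfies: every star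
through a link of positive profile has its centre and locality set INSIDE `Λ₀` and avoids `Δg`; `ℓ` drops by at most one from a link of
a star to a link of its locality set; and `ℓ ≥ min(⌊dist(Δf, Δg)/(D+2)⌋, ⌊m/(D+2)⌋)` on `Δf` whenever `φ ≥ m` on `Δf` (ds-2's
`exists_starProfileR` with the box replaced by the depth function). [folklore] -/
theorem exists_starKernelProfile {D : ℕ} (hD : 1 ≤ D) {nbhd : ZdEdge d → Finset (ZdEdge d)}
    (hnbhd : ∀ (c : ZdEdge d), ∀ y ∈ nbhd c, ∀ i, (y.1 i - c.1 i).natAbs ≤ D)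
    (K : Site d → ZdEdge d → ZdEdge d → ℝ) (hKsupp : ∀ (c : ZdEdge d) (y x : ZdEdge d), K c.1 y x ≠ 0 → y ∈ nbhd c)
    (Λ₀ Δf Δg : Finset (ZdEdge d)) (φ : ZdEdge d → ℝ) (hφ : ∀ x y : ZdEdge d, φ x ≤ φ y + ‖x.1 - y.1‖)
    (hφΛ : ∀ x, 0 < φ x → x ∈ Λ₀) {m : ℝ} (hm : ∀ x ∈ Δf, m ≤ φ x) :
    ∃ ℓ : ZdEdge d → ℕ,
      (∀ x, ℓ x ≠ 0 → ∀ c, x ∈ starWinZd c → c ∈ Λ₀ ∧ nbhd c ⊆ Λ₀ ∧ ∀ z ∈ starWinZd c, z ∉ Δg) ∧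
      (∀ c x y, x ∈ starWinZd c → K c.1 y x ≠ 0 → ℓ x ≤ ℓ y + 1) ∧
      (∀ x ∈ Δf, min (⌊setDistEdges Δf Δg / (D + 2 : ℕ)⌋₊) (⌊m / (D + 2 : ℕ)⌋₊) ≤ ℓ x) := by
  classical
  have hD2 : (0 : ℝ) < (D + 2 : ℕ) := by positivity
  -- sup-distance bookkeeping: links of a star / of a locality set are close to the centre
  have hstar : ∀ {c x : ZdEdge d}, x ∈ starWinZd c → ‖c.1 - x.1‖ ≤ 1 := fun {c x} hxc => by
    have h := norm_le_of_natAbs_le (a := c.1 - x.1) (n := 1) fun i => by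
      have h := natAbs_sub_le_one_of_mem_vertexStarZd hxc i
      rw [Pi.sub_apply, ← Int.natAbs_neg, neg_sub]
      exact h
    exact_mod_cast h
  have hfloor : ∀ a : ℝ, ⌊a + 1⌋₊ ≤ ⌊a⌋₊ + 1 := fun a => by
    rcases le_or_gt 0 a with ha | ha
    · rw [Nat.floor_add_one ha]
    · rw [Nat.floor_eq_zero.2 (by linarith : a + 1 < 1)]
      exact Nat.zero_le _
  have hnb : ∀ {c y : ZdEdge d}, y ∈ nbhd c → ‖y.1 - c.1‖ ≤ D := fun {c y} hy => by
    refine norm_le_of_natAbs_le fun i => ?_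
    rw [Pi.sub_apply]
    exact hnbhd c y hy i
  refine ⟨fun x => min (⌊linkSetDist Δg x / (D + 2 : ℕ)⌋₊) (⌊φ x / (D + 2 : ℕ)⌋₊), ?_, ?_, ?_⟩
  · intro x hx c hxc
    have hx1 : ⌊linkSetDist Δg x / (D + 2 : ℕ)⌋₊ ≠ 0 := by
      intro h; apply hx; show min _ _ = 0; rw [h, Nat.zero_min]
    have hx2 : ⌊φ x / (D + 2 : ℕ)⌋₊ ≠ 0 := by
      intro h; apply hx; show min _ _ = 0; rw [h, Nat.min_zero]
    have hdist : ((D + 2 : ℕ) : ℝ) ≤ linkSetDist Δg x := by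
      by_contra h
      exact hx1 (Nat.floor_eq_zero.2 ((div_lt_one hD2).2 (not_le.mp h)))
    have hdepth : ((D + 2 : ℕ) : ℝ) ≤ φ x := by
      by_contra h
      exact hx2 (Nat.floor_eq_zero.2 ((div_lt_one hD2).2 (not_le.mp h)))
    have hD2' : ((D + 2 : ℕ) : ℝ) = D + 2 := by push_cast; ring
    have hxc' : ‖x.1 - c.1‖ ≤ 1 := by rw [norm_sub_rev]; exact hstar hxc
    have hD0 : (1 : ℝ) ≤ D := by exact_mod_cast hD
    refine ⟨hφΛ c ?_, fun y hy => hφΛ y ?_, fun z hz hzg => ?_⟩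
    · have h1 := hφ x c
      linarith
    · have h1 := hφ x y
      have e2 : ‖c.1 - y.1‖ ≤ D := by rw [norm_sub_rev]; exact hnb hy
      have h2 : ‖x.1 - y.1‖ ≤ D + 1 := by
        calc ‖x.1 - y.1‖ = ‖(x.1 - c.1) + (c.1 - y.1)‖ := by congr 1; abel
          _ ≤ ‖x.1 - c.1‖ + ‖c.1 - y.1‖ := norm_add_le _ _
          _ ≤ 1 + D := add_le_add hxc' e2
          _ = D + 1 := add_comm _ _
      linarith
    · have hzx : ‖x.1 - z.1‖ ≤ (2 : ℕ) := by
        refine norm_le_of_natAbs_le fun i => ?_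
        have h1 := natAbs_sub_le_one_of_mem_vertexStarZd hxc i
        have h2 := natAbs_sub_le_one_of_mem_vertexStarZd hz i
        simp only [Pi.sub_apply]
        omega
      have h0 : linkSetDist Δg z = 0 := linkSetDist_eq_zero_of_mem hzg
      have h3 := linkSetDist_le_add_norm Δg x z
      push_cast at hzx hdist
      linarith
  · intro c x y hxc hK
    have hy : y ∈ nbhd c := hKsupp _ _ _ hK
    have hyx : ‖x.1 - y.1‖ ≤ ((D + 1 : ℕ) : ℝ) := by
      refine norm_le_of_natAbs_le fun i => ?_
      have h1 := natAbs_sub_le_one_of_mem_vertexStarZd hxc i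
      have h2 := hnbhd c y hy i
      simp only [Pi.sub_apply]
      omega
    have hD12 : ((D + 1 : ℕ) : ℝ) ≤ ((D + 2 : ℕ) : ℝ) := by exact_mod_cast Nat.le_succ _
    have hfl1 : ⌊linkSetDist Δg x / (D + 2 : ℕ)⌋₊ ≤ ⌊linkSetDist Δg y / (D + 2 : ℕ)⌋₊ + 1 := by
      have h1 : linkSetDist Δg x / (D + 2 : ℕ) ≤ linkSetDist Δg y / (D + 2 : ℕ) + 1 := by
        rw [div_add_one hD2.ne', div_le_div_iff_of_pos_right hD2]
        have h3 := linkSetDist_le_add_norm Δg x y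
        linarith
      calc ⌊linkSetDist Δg x / (D + 2 : ℕ)⌋₊ ≤ ⌊linkSetDist Δg y / (D + 2 : ℕ) + 1⌋₊ := Nat.floor_mono h1
        _ = ⌊linkSetDist Δg y / (D + 2 : ℕ)⌋₊ + 1 :=
            Nat.floor_add_one (div_nonneg (linkSetDist_nonneg _ _) hD2.le)
    have hfl2 : ⌊φ x / (D + 2 : ℕ)⌋₊ ≤ ⌊φ y / (D + 2 : ℕ)⌋₊ + 1 := by
      have h1 : φ x / (D + 2 : ℕ) ≤ φ y / (D + 2 : ℕ) + 1 := by
        rw [div_add_one hD2.ne', div_le_div_iff_of_pos_right hD2]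
        have h3 := hφ x y
        linarith
      calc ⌊φ x / (D + 2 : ℕ)⌋₊ ≤ ⌊φ y / (D + 2 : ℕ) + 1⌋₊ := Nat.floor_mono h1
        _ ≤ ⌊φ y / (D + 2 : ℕ)⌋₊ + 1 := hfloor _
    calc min (⌊linkSetDist Δg x / (D + 2 : ℕ)⌋₊) (⌊φ x / (D + 2 : ℕ)⌋₊)
        ≤ min (⌊linkSetDist Δg y / (D + 2 : ℕ)⌋₊ + 1) (⌊φ y / (D + 2 : ℕ)⌋₊ + 1) := min_le_min hfl1 hfl2
      _ = min (⌊linkSetDist Δg y / (D + 2 : ℕ)⌋₊) (⌊φ y / (D + 2 : ℕ)⌋₊) + 1 := min_add_add_right _ _ _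
  · intro x hx
    refine min_le_min ?_ ?_
    · exact Nat.floor_mono (div_le_div_of_nonneg_right (setDistEdges_le_linkSetDist hx) hD2.le)
    · exact Nat.floor_mono (div_le_div_of_nonneg_right (hm x hx) hD2.le)

/-! ### Door level: any star array of locality radius `D` on `ℤ^d` -/

/-- ★★ **FINITE-VOLUME CLUSTERING WITH ANY BOUNDARY FIELD THROUGH A `ℤ^d` STAR DOOR, interior form.** Let `γ` be a specification on
the links of `ℤ^d` with `SU(N)` spins (`IsSpecification`) whose star kernels are quasilocal with locality sets `nbhd c ⊇ starWinZd c` of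
radius `D ≥ 1` (`hloc`), carrying a star array `K ≥ 0` supported in the locality sets with the sitewise window contraction (H1) for the
Frobenius weight and per-star received sum `≤ ρ < 1`. Then for EVERY finite link volume `Λ₀`, EVERY boundary field `η`, every depth
function `φ` of `Λ₀` (`1`-Lipschitz, `φ > 0 ⇒ ∈ Λ₀`), bounded measurable `f` (links `Δf ⊆ Λ₀`, `φ ≥ m` on `Δf`), `g` (links `Δg`) with
Frobenius-Lipschitz vectors `δf, δg`:
`|cov_{γ_{Λ₀}(·|η)}(f, g)| ≤ 2(2√N)² ρ^{min(⌊dist(Δf,Δg)/(D+2)⌋, ⌊m/(D+2)⌋)} (Σ δf)(Σ δg)` — the Literature's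
`DobrushinShlosman.abs_covariance_kernel_le_of_window_geometric` with the kernel profile `exists_starKernelProfile`. [folklore] -/
theorem abs_covariance_kernel_le_of_starArray {γ : Specification (ZdEdge d) (SUN N)} (hγ : IsSpecification γ)
    {D : ℕ} (hD : 1 ≤ D) {nbhd : ZdEdge d → Finset (ZdEdge d)} (hwin : ∀ c, starWinZd c ⊆ nbhd c)
    (hnbhd : ∀ (c : ZdEdge d), ∀ y ∈ nbhd c, ∀ i, (y.1 i - c.1 i).natAbs ≤ D)
    (hloc : ∀ (c : ZdEdge d) (ζ ζ' : LGConfig d (SUN N)), (∀ v ∈ nbhd c, ζ v = ζ' v) →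
      ∀ (f : LGConfig d (SUN N) → ℝ), Measurable f → (∃ B, ∀ σ, |f σ| ≤ B) →
        DependsOn f (starWinZd c : Set (ZdEdge d)) →
        ∫ σ, f σ ∂(γ (starWinZd c) ζ) = ∫ σ, f σ ∂(γ (starWinZd c) ζ'))
    {K : Site d → ZdEdge d → ZdEdge d → ℝ} (hK0 : ∀ s y x, 0 ≤ K s y x)
    (hKsupp : ∀ (c : ZdEdge d) (y x : ZdEdge d), K c.1 y x ≠ 0 → y ∈ nbhd c)
    (hcontract : ∀ (c y : ZdEdge d), y ∉ starWinZd c →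
      ∀ (ω η : LGConfig d (SUN N)), (∀ v, v ≠ y → ω v = η v) →
      ∀ (f : LGConfig d (SUN N) → ℝ) (δ : ZdEdge d → ℝ),
        Measurable f → (∃ B, ∀ σ, |f σ| ≤ B) → DependsOn f (starWinZd c : Set (ZdEdge d)) →
        (∀ x, 0 ≤ δ x) →
        (∀ (x : ZdEdge d) (σ τ : LGConfig d (SUN N)), (∀ v, v ≠ x → σ v = τ v) →
          |f σ - f τ| ≤ δ x * suFrobDist (σ x) (τ x)) →
          |∫ σ, f σ ∂(γ (starWinZd c) ω) - ∫ σ, f σ ∂(γ (starWinZd c) η)| ≤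
            (∑ x ∈ starWinZd c, K c.1 y x * δ x) * suFrobDist (ω y) (η y))
    {ρ : ℝ} (hρ0 : 0 ≤ ρ) (hρ1 : ρ < 1) (hsum : ∀ (c : ZdEdge d), ∀ x ∈ starWinZd c, ∑ y ∈ nbhd c, K c.1 y x ≤ ρ)
    (Λ₀ : Finset (ZdEdge d)) (η : LGConfig d (SUN N)) (φ : ZdEdge d → ℝ)
    (hφ : ∀ x y : ZdEdge d, φ x ≤ φ y + ‖x.1 - y.1‖) (hφΛ : ∀ x, 0 < φ x → x ∈ Λ₀)
    {f g : LGConfig d (SUN N) → ℝ} (hfm : Measurable f) (hgm : Measurable g) {Bf Bg : ℝ}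
    (hBf : ∀ σ, |f σ| ≤ Bf) (hBg : ∀ σ, |g σ| ≤ Bg) {Δf Δg : Finset (ZdEdge d)}
    (hfdep : DependsOn f (Δf : Set (ZdEdge d))) (hgdep : DependsOn g (Δg : Set (ZdEdge d)))
    {δf δg : ZdEdge d → ℝ} (hδf : IsLipBound suFrobDist f δf) (hδg : IsLipBound suFrobDist g δg)
    (hΔf : Δf ⊆ Λ₀) {m : ℝ} (hm : ∀ x ∈ Δf, m ≤ φ x) :
    |cov[f, g; γ Λ₀ η]| ≤ 2 * (2 * Real.sqrt N) ^ 2 *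
      ρ ^ (min (⌊setDistEdges Δf Δg / (D + 2 : ℕ)⌋₊) (⌊m / (D + 2 : ℕ)⌋₊)) *
      (∑ x ∈ Δf, δf x) * ∑ y ∈ Δg, δg y := by
  classical
  have hR₀ : (0 : ℝ) ≤ 2 * Real.sqrt N := by positivity
  obtain ⟨ℓ, hU, hℓ, hL⟩ := exists_starKernelProfile hD hnbhd K hKsupp Λ₀ Δf Δg φ hφ hφΛ hm
  exact DobrushinShlosman.abs_covariance_kernel_le_of_window_geometric hγ suFrobDist_nonneg suFrobDist_le hR₀
    (win := starWinZd) (nbhd := nbhd) (K := fun c => K c.1) (fun c y x => hK0 _ _ _)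
    self_mem_starWinZd hwin (fun c y x => hKsupp c y x) hcontract hloc hρ0 hρ1 (fun c x hx => hsum c x hx)
    Λ₀ η hfm hgm hBf hBg hfdep hgdep hδf hδg hΔf ℓ _ hU hℓ hL

/-- **Through ds-2's radius-`D` star door `StarWindowBoundZdR γ D ρ suFrobDist`** (any specification with radius-`D` quasilocal star
kernels, e.g. every tier-1 member via `starWindowBoundZdR_of_memBallZdG` and `perturbed_star_hloc`): for every finite `Λ₀`, every `η`,
every depth function `φ` of `Λ₀`: `|cov_{γ_{Λ₀}(·|η)}(f, g)| ≤ 2(2√N)² ρ^{min(⌊dist(Δf,Δg)/(D+2)⌋, ⌊m/(D+2)⌋)} (Σ δf)(Σ δg)`.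
[folklore] -/
theorem abs_covariance_kernel_le_of_starWindowBoundZdR {γ : Specification (ZdEdge d) (SUN N)}
    (hγ : IsSpecification γ) {D : ℕ} (hD : 1 ≤ D)
    (hloc : ∀ (c : ZdEdge d) (ζ ζ' : LGConfig d (SUN N)), (∀ v ∈ starNbhdZdR D c.1, ζ v = ζ' v) →
      ∀ (f : LGConfig d (SUN N) → ℝ), Measurable f → (∃ B, ∀ σ, |f σ| ≤ B) →
        DependsOn f (starWinZd c : Set (ZdEdge d)) →
        ∫ σ, f σ ∂(γ (starWinZd c) ζ) = ∫ σ, f σ ∂(γ (starWinZd c) ζ'))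
    {ρ : ℝ} (hρ0 : 0 ≤ ρ) (hρ1 : ρ < 1) (h : StarWindowBoundZdR d N γ D ρ suFrobDist)
    (Λ₀ : Finset (ZdEdge d)) (η : LGConfig d (SUN N)) (φ : ZdEdge d → ℝ)
    (hφ : ∀ x y : ZdEdge d, φ x ≤ φ y + ‖x.1 - y.1‖) (hφΛ : ∀ x, 0 < φ x → x ∈ Λ₀)
    {f g : LGConfig d (SUN N) → ℝ} (hfm : Measurable f) (hgm : Measurable g) {Bf Bg : ℝ}
    (hBf : ∀ σ, |f σ| ≤ Bf) (hBg : ∀ σ, |g σ| ≤ Bg) {Δf Δg : Finset (ZdEdge d)}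
    (hfdep : DependsOn f (Δf : Set (ZdEdge d))) (hgdep : DependsOn g (Δg : Set (ZdEdge d)))
    {δf δg : ZdEdge d → ℝ} (hδf : IsLipBound suFrobDist f δf) (hδg : IsLipBound suFrobDist g δg)
    (hΔf : Δf ⊆ Λ₀) {m : ℝ} (hm : ∀ x ∈ Δf, m ≤ φ x) :
    |cov[f, g; γ Λ₀ η]| ≤ 2 * (2 * Real.sqrt N) ^ 2 *
      ρ ^ (min (⌊setDistEdges Δf Δg / (D + 2 : ℕ)⌋₊) (⌊m / (D + 2 : ℕ)⌋₊)) *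
      (∑ x ∈ Δf, δf x) * ∑ y ∈ Δg, δg y := by
  obtain ⟨K, hK0, hKsupp, hcontract, hsum⟩ := h
  exact abs_covariance_kernel_le_of_starArray hγ hD (nbhd := fun c => starNbhdZdR D c.1)
    (fun c => vertexStarZd_subset_starNbhdZdR hD c.1) (fun c y hy i => (mem_starNbhdZdR.1 hy) i) hloc hK0
    (fun c y x h => hKsupp _ _ _ h) hcontract hρ0 hρ1 (fun c x hx => hsum c.1 x hx) Λ₀ η φ hφ hφΛ hfm hgm hBf hBg hfdep hgdep
    hδf hδg hΔf hm

/-- **Through ds-1's Wilson star door `StarWindowBoundZd d N β ρ suFrobDist`** (Wilson action at bare coupling `β`, locality sets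
`starNbhdZd` of radius `2`, quasilocality by `dependsOn_integral_ymSpecification`): for every finite `Λ₀`, every `η`, every depth
function `φ` of `Λ₀`: `|cov_{γ_{Λ₀}(·|η)}(f, g)| ≤ 2(2√N)² ρ^{min(⌊dist(Δf,Δg)/4⌋, ⌊m/4⌋)} (Σ δf)(Σ δg)`. [folklore] -/
theorem abs_covariance_kernel_le_of_starWindowBoundZd {β ρ : ℝ} (hρ0 : 0 ≤ ρ) (hρ1 : ρ < 1)
    (h : StarWindowBoundZd d N β ρ suFrobDist)
    (Λ₀ : Finset (ZdEdge d)) (η : LGConfig d (SUN N)) (φ : ZdEdge d → ℝ)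
    (hφ : ∀ x y : ZdEdge d, φ x ≤ φ y + ‖x.1 - y.1‖) (hφΛ : ∀ x, 0 < φ x → x ∈ Λ₀)
    {f g : LGConfig d (SUN N) → ℝ} (hfm : Measurable f) (hgm : Measurable g) {Bf Bg : ℝ}
    (hBf : ∀ σ, |f σ| ≤ Bf) (hBg : ∀ σ, |g σ| ≤ Bg) {Δf Δg : Finset (ZdEdge d)}
    (hfdep : DependsOn f (Δf : Set (ZdEdge d))) (hgdep : DependsOn g (Δg : Set (ZdEdge d)))
    {δf δg : ZdEdge d → ℝ} (hδf : IsLipBound suFrobDist f δf) (hδg : IsLipBound suFrobDist g δg)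
    (hΔf : Δf ⊆ Λ₀) {m : ℝ} (hm : ∀ x ∈ Δf, m ≤ φ x) :
    |cov[f, g; ymSpecification (d := d) (fundamentalRep (Fin N)) β Λ₀ η]| ≤ 2 * (2 * Real.sqrt N) ^ 2 *
      ρ ^ (min (⌊setDistEdges Δf Δg / (2 + 2 : ℕ)⌋₊) (⌊m / (2 + 2 : ℕ)⌋₊)) *
      (∑ x ∈ Δf, δf x) * ∑ y ∈ Δg, δg y := by
  classical
  haveI : SecondCountableTopology (Matrix (Fin N) (Fin N) ℂ) :=
    inferInstanceAs (SecondCountableTopology (Fin N → Fin N → ℂ))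
  haveI : SecondCountableTopology (SUN N) := Topology.IsEmbedding.subtypeVal.secondCountableTopology
  have hγ : IsSpecification (ymSpecification (d := d) (fundamentalRep (Fin N)) β) :=
    isSpecification_ymSpecification_of_t2Space _ (continuous_fundamentalRep (Fin N)) _
  obtain ⟨K, hK0, hKsupp, hcontract, hsum⟩ := h
  -- locality of the Wilson star kernels (finite range of the Wilson interaction)
  have hloc : ∀ (c : ZdEdge d) (ζ ζ' : LGConfig d (SUN N)), (∀ v ∈ starNbhdZd c.1, ζ v = ζ' v) →
      ∀ (f : LGConfig d (SUN N) → ℝ), Measurable f → (∃ B, ∀ σ, |f σ| ≤ B) →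
        DependsOn f (starWinZd c : Set (ZdEdge d)) →
        ∫ σ, f σ ∂(ymSpecification (d := d) (fundamentalRep (Fin N)) β (starWinZd c) ζ) =
          ∫ σ, f σ ∂(ymSpecification (d := d) (fundamentalRep (Fin N)) β (starWinZd c) ζ') := by
    intro c ζ ζ' hζ f hfm' _ hfdep'
    exact dependsOn_integral_ymSpecification (fundamentalRep (Fin N)) (continuous_fundamentalRep (Fin N))
      β (starWinZd c) hfm' hfdep' fun v hv => hζ v (Finset.mem_coe.1 hv)
  exact abs_covariance_kernel_le_of_starArray hγ (D := 2) (by norm_num) (nbhd := fun c => starNbhdZd c.1)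
    (fun c => vertexStarZd_subset_starNbhdZd c.1) (fun c y hy i => natAbs_sub_le_two_of_mem_starNbhdZd hy i) hloc hK0
    (fun c y x h' => hKsupp _ _ _ h') hcontract hρ0 hρ1 (fun c x hx => hsum c.1 x hx) Λ₀ η φ hφ hφΛ hfm hgm hBf hBg hfdep
    hgdep hδf hδg hΔf hm

/-! ### `SU(2)` lattice Yang–Mills on `ℤ⁴` at every `0 ≤ β_W ≤ 9/25`, hypothesis-free -/

/-- ★★★ **`SU(2)`, `d = 4`, WILSON ACTION, EVERY `0 ≤ β_W ≤ 9/25`: FINITE-VOLUME CLUSTERING WITH ANY BOUNDARY FIELD, interior form,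
HYPOTHESIS-FREE** (tree bare coupling `β_W/2`). For every finite link volume `Λ₀`, EVERY boundary field `η`, every depth function `φ` of
`Λ₀` (`1`-Lipschitz in the sup-norm of base points, `φ > 0 ⇒ ∈ Λ₀`) and Lipschitz cylinders `F₁` (links `Λ₁ ⊆ Λ₀` with `φ ≥ m` on `Λ₁`,
constant `K₁`), `F₂` (links `Λ₂`, constant `K₂`):
`|cov_{γ_{Λ₀}(·|η)}(F₁, F₂)| ≤ 16 · #Λ₁ #Λ₂ K₁ K₂ · R_G(β_W)^{min(⌊dist(Λ₁,Λ₂)/4⌋, ⌊m/4⌋)}` (`R_G(β_W) < 1` iff `β_W < 0.3609…`) — Lemma G on the torus of side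
`5` (`starWindowBound_lemmaG`), the torus → `ℤ⁴` transfer (`starWindowBoundZd_of_starWindowBound`) and the kernel star door above. This
extends the seat's single-link kernel clustering cells (`β_W < 1/6`) to the whole vertex-star window. [folklore] -/
theorem su2_wilson_kernel_clustering_star {βW : ℝ} (h0 : 0 ≤ βW) (h : βW ≤ 9 / 25)
    (Λ₀ : Finset (ZdEdge 4)) (η : LGConfig 4 (SUN 2)) (φ : ZdEdge 4 → ℝ)
    (hφ : ∀ x y : ZdEdge 4, φ x ≤ φ y + ‖x.1 - y.1‖) (hφΛ : ∀ x, 0 < φ x → x ∈ Λ₀)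
    {F₁ F₂ : LGConfig 4 (SUN 2) → ℝ} {Λ₁ Λ₂ : Finset (ZdEdge 4)} {K₁ K₂ : ℝ≥0}
    (hF₁ : IsLipschitzCylinder (fundamentalRep (Fin 2)) F₁ Λ₁ K₁)
    (hF₂ : IsLipschitzCylinder (fundamentalRep (Fin 2)) F₂ Λ₂ K₂) (hΛ₁ : Λ₁ ⊆ Λ₀) {m : ℝ} (hm : ∀ x ∈ Λ₁, m ≤ φ x) :
    |cov[F₁, F₂; ymSpecification (d := 4) (fundamentalRep (Fin 2)) (βW / 2) Λ₀ η]| ≤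
      16 * Λ₁.card * Λ₂.card * ((K₁ : ℝ) * K₂) *
        gaugeR βW ^ (min (⌊setDistEdges Λ₁ Λ₂ / (4 : ℕ)⌋₊) (⌊m / (4 : ℕ)⌋₊)) := by
  have hρ0 : 0 ≤ gaugeR βW := gaugeR_nonneg h0 (by linarith)
  have hρ1 : gaugeR βW < 1 := gaugeR_lt_one_of_le h0 h
  have hZd : StarWindowBoundZd 4 2 (βW / 2) (gaugeR βW) suFrobDist :=
    starWindowBoundZd_of_starWindowBound (L := 5) le_rfl suFrobDist_nonneg (starWindowBound_lemmaG (by norm_num) h0 (by linarith))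
  have hA : ∀ a b : SUN 2, dist (suEntries a) (suEntries b) ≤ 1 * suFrobDist a b := fun a b => by
    rw [one_mul]; exact dist_suEntries_le_suFrobDist a b
  have key := abs_covariance_kernel_le_of_starWindowBoundZd (d := 4) (N := 2) hρ0 hρ1 hZd Λ₀ η φ hφ hφΛ
    hF₁.measurable hF₂.measurable hF₁.abs_le hF₂.abs_le hF₁.dependsOn hF₂.dependsOn
    (hF₁.isLipBound zero_le_one hA) (hF₂.isLipBound zero_le_one hA) hΛ₁ hm
  have hK₁ : (0 : ℝ) ≤ K₁ := K₁.2
  have hK₂ : (0 : ℝ) ≤ K₂ := K₂.2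
  have hsum₁ : ∑ y ∈ Λ₁, (if y ∈ Λ₁ then 1 * (K₁ : ℝ) else 0) = Λ₁.card * K₁ := by
    rw [Finset.sum_ite_of_true (fun y hy => hy), Finset.sum_const, nsmul_eq_mul, one_mul]
  have hsum₂ : ∑ y ∈ Λ₂, (if y ∈ Λ₂ then 1 * (K₂ : ℝ) else 0) = Λ₂.card * K₂ := by
    rw [Finset.sum_ite_of_true (fun y hy => hy), Finset.sum_const, nsmul_eq_mul, one_mul]
  have hsq : (2 * Real.sqrt (2 : ℕ)) ^ 2 = 8 := by
    rw [mul_pow, Real.sq_sqrt (by positivity)]; norm_num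
  have h22 : (2 + 2 : ℕ) = 4 := by norm_num
  rw [hsum₁, hsum₂, hsq, h22] at key
  calc |cov[F₁, F₂; ymSpecification (d := 4) (fundamentalRep (Fin 2)) (βW / 2) Λ₀ η]|
      ≤ 2 * 8 * gaugeR βW ^ (min (⌊setDistEdges Λ₁ Λ₂ / (4 : ℕ)⌋₊) (⌊m / (4 : ℕ)⌋₊)) *
          (Λ₁.card * K₁) * (Λ₂.card * K₂) := key
    _ = 16 * Λ₁.card * Λ₂.card * ((K₁ : ℝ) * K₂) *
        gaugeR βW ^ (min (⌊setDistEdges Λ₁ Λ₂ / (4 : ℕ)⌋₊) (⌊m / (4 : ℕ)⌋₊)) := by ring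

/-- **The box.** For `Λ₀ =` the links based in `box 4 M` (all `x` with `‖x.1‖_∞ ≤ M`) the function `φ x = M + 1 − ‖x.1‖_∞` is a depth
function, and a Lipschitz cylinder on links based in `box 4 M'`, `M' ≤ M`, has depth `≥ M + 1 − M'`: for `0 ≤ β_W ≤ 9/25`, EVERY boundary
field `η` on the box and Lipschitz cylinders `F₁` (links based in `box 4 M'`), `F₂`:
`|cov_{γ_{box M}(·|η)}(F₁, F₂)| ≤ 16 #Λ₁ #Λ₂ K₁ K₂ · R_G(β_W)^{min(⌊dist(Λ₁,Λ₂)/4⌋, ⌊(M + 1 − M')/4⌋)}`. [folklore] -/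
theorem su2_wilson_kernel_clustering_star_box {βW : ℝ} (h0 : 0 ≤ βW) (h : βW ≤ 9 / 25) {M M' : ℕ} (hMM : M' ≤ M)
    (η : LGConfig 4 (SUN 2)) {F₁ F₂ : LGConfig 4 (SUN 2) → ℝ} {Λ₁ Λ₂ : Finset (ZdEdge 4)} {K₁ K₂ : ℝ≥0}
    (hF₁ : IsLipschitzCylinder (fundamentalRep (Fin 2)) F₁ Λ₁ K₁)
    (hF₂ : IsLipschitzCylinder (fundamentalRep (Fin 2)) F₂ Λ₂ K₂)
    (hΛ₁ : Λ₁ ⊆ (box 4 M') ×ˢ (Finset.univ : Finset (Fin 4))) :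
    |cov[F₁, F₂; ymSpecification (d := 4) (fundamentalRep (Fin 2)) (βW / 2)
        ((box 4 M) ×ˢ (Finset.univ : Finset (Fin 4))) η]| ≤
      16 * Λ₁.card * Λ₂.card * ((K₁ : ℝ) * K₂) *
        gaugeR βW ^ (min (⌊setDistEdges Λ₁ Λ₂ / (4 : ℕ)⌋₊) (⌊((M : ℝ) + 1 - M') / (4 : ℕ)⌋₊)) := by
  classical
  have hΛ₁' : Λ₁ ⊆ (box 4 M) ×ˢ (Finset.univ : Finset (Fin 4)) := fun x hx => by
    have h1 := Finset.mem_product.1 (hΛ₁ hx)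
    refine Finset.mem_product.2 ⟨mem_box.2 fun i => ?_, Finset.mem_univ _⟩
    have := (mem_box.1 h1.1) i
    omega
  refine su2_wilson_kernel_clustering_star h0 h _ η (fun x => (M : ℝ) + 1 - supNormZd x.1)
    (fun x y => ?_) (fun x hx => ?_) hF₁ hF₂ hΛ₁' (fun x hx => ?_)
  · have h1 := supNormZd_le_supNormZd_add_norm y.1 x.1
    rw [norm_sub_rev] at h1
    linarith
  · refine Finset.mem_product.2 ⟨mem_box.2 fun i => ?_, Finset.mem_univ _⟩
    have h1 : (supNormZd x.1 : ℝ) < M + 1 := by linarith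
    have h1' : supNormZd x.1 < M + 1 := by exact_mod_cast h1
    have h2 : supNormZd x.1 ≤ M := Nat.lt_succ_iff.1 h1'
    have h3 := natAbs_le_supNormZd x.1 i
    omega
  · have h1 := Finset.mem_product.1 (hΛ₁ hx)
    have h2 : supNormZd x.1 ≤ M' := supNormZd_le_iff.2 fun i => by
      have := (mem_box.1 h1.1) i
      omega
    have h3 : (supNormZd x.1 : ℝ) ≤ M' := by exact_mod_cast h2
    linarith

end Summit.Ventures.YMGap.RobustBall

end
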